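import Summits.QuantumFields.YangMills.Theorems.SwapVirialDeficitZeroModeGroupFourSmallBallRegions
import HarnessLib

/-!
# Exact zero-mode rung, FOUR pairwise nearly commuting letters — XI: explicit two-sided bounds for the radial integral `I(t)`
# (zero-mode block of crux ⟨stmt-QuantumFields-24497⟩ `ToronTubeVolumeLaw`; free-hands support of ⟨stmt-QuantumFields-24197⟩ / ⟨24497⟩)

With `I(t) := ∫ da₀ ∫_{ρ>0} radK t a₀ ρ dρ` (so that `Haar⁴(N₄(t)) = t⁶·c⁴·4π·I(t)`, §38), the three regional estimates of part X integrate in `a₀` to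
★★ `Irad_le` / ★★ `le_Irad` (§40):  for `0 < a ≤ δ ≤ 1`, `0 < r₀`, and constants `B⁺ ≥ V_t` resp. `B⁻ ≤ V_t` on the middle region off `|a₀| ≤ r₀`,
`log(δ/a)/64 · ((1−δ²)² − r₀⁴)/2 · B⁻ ≤ I(t) ≤ 2(a√2/(64√t))·C_dec + 2/(64δ)·D + log(δ/a)/64·(8r₀·D + (1/2 + 6δ)·B⁺)`,
`D = vol³(domSet4)`.  Here `∫_{a₀²<1}|a₀|³ da₀ = 1/2` and `(a₀²+δ²)^{3/2} ≤ |a₀|³ + 3δ` (§39).  With `a = A√t`, `log(δ/a) = ½log(1/t) + log(δ/A)`, so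
both sides are `½·log(1/t)/64 · (h(0)/2 + o(1))` once `B^± = h(0) ± ε` (✓IX): `I(t)/log(1/t) → h(0)/256`, i.e. `N₄(t) ~ (π c⁴ h(0)/64)·t⁶ log(1/t)` (part XII).
HONEST LABEL: finite-dimensional measure theory on `SU(2)⁴` (plan-level zero-mode rung of DRAFT lines); NOT ⟨24497⟩, NOT ⟨24197⟩; the Yang–Mills mass gap
is NOT proved; no summit is proved by a line.  Seat ym-line-fcl-p3 g44 (cell ym-idea-1, free hands), `--supports stmt-QuantumFields-24197`.  Standard axioms
(one auxiliary def `Irad`).  References: [cite: GonzalezarroyoAltes1988]; [cite: Vanbaal2001]; [folklore].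
-/

set_option autoImplicit false

noncomputable section

open MeasureTheory Quaternion Set Real
open scoped Quaternion ENNReal BigOperators
open Literature.MathematicalPhysics.QuantumLattice
open Summit.QuantumFields.YangMills.Theorems.SwapTwistDeficit.ToronLog

attribute [local instance] Literature.Analysis.FluidPDE.Tao2016.quatMeasurableSpace
  Literature.Analysis.FluidPDE.Tao2016.quatBorelSpace
  Literature.MathematicalPhysics.QuantumLattice.secondCountableTopology_su2

namespace Summit.QuantumFields.YangMills.Theorems.SwapVirialDeficit.ZeroModeGroup

/-! ## §38 The radial integral `I(t)` -/

/-- `I(t) = ∫ da₀ ∫_{ρ>0} radK t a₀ ρ dρ`. [folklore] -/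
def Irad (t : ℝ) : ℝ≥0∞ := ∫⁻ r : ℝ, ∫⁻ ρ in Ioi (0 : ℝ), radK t r ρ

/-- `radK` as the indicator of a planar set evaluated at `(a₀, ρ)`. [folklore] -/
theorem radK_eq_indicator (t r ρ : ℝ) :
    radK t r ρ = {p : ℝ × ℝ | p.1 ^ 2 + p.2 ^ 2 < 1}.indicator (fun p => ENNReal.ofReal (p.2 ^ 2) * hubFun t p.1 (p.2 ^ 2)) (r, ρ) := by
  unfold radK
  simp only [Set.indicator_apply, Set.mem_setOf_eq]

/-- `radK t` is jointly measurable in `(a₀, ρ)`. [folklore] -/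
theorem measurable_radK (t : ℝ) : Measurable fun p : ℝ × ℝ => radK t p.1 p.2 := by
  have hs : MeasurableSet {p : ℝ × ℝ | p.1 ^ 2 + p.2 ^ 2 < 1} :=
    measurableSet_lt ((measurable_fst.pow_const 2).add (measurable_snd.pow_const 2)) measurable_const
  have h0 : Measurable (fun q : ℝ × ℝ => hubFun t q.1 q.2) := measurable_hubFun t
  have h1 : Measurable fun p : ℝ × ℝ => (p.1, p.2 ^ 2) := measurable_fst.prodMk (measurable_snd.pow_const 2)
  have h01 := h0.comp h1
  have hV : Measurable fun p : ℝ × ℝ => hubFun t p.1 (p.2 ^ 2) := h01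
  have hf : Measurable fun p : ℝ × ℝ => ENNReal.ofReal (p.2 ^ 2) * hubFun t p.1 (p.2 ^ 2) :=
    (ENNReal.measurable_ofReal.comp (measurable_snd.pow_const 2)).mul hV
  simp_rw [radK_eq_indicator]
  exact (hf.indicator hs).comp (measurable_fst.prodMk measurable_snd)

/-- `a₀ ↦ ∫_{S} radK t a₀` is measurable for every set `S`. [folklore] -/
theorem measurable_lintegral_radK (t : ℝ) (S : Set ℝ) : Measurable fun r : ℝ => ∫⁻ ρ in S, radK t r ρ :=
  (measurable_radK t).lintegral_prod_right' (ν := volume.restrict S)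

/-- ★ **`Haar⁴(N₄(t)) = t⁶·c³·(c·(4π·I(t)))`** (`t > 0`). [folklore] -/
theorem haar_nearlyCommuting_eq_Irad {t : ℝ} (ht : 0 < t) :
    (Measure.pi fun _ : Fin 4 => Literature.MathematicalPhysics.QuantumFieldTheory.haarProbability (Matrix.specialUnitaryGroup (Fin 2) ℂ)) (nearlyCommuting t) =
      ENNReal.ofReal (t ^ 6) * ((ENNReal.ofReal coneConst * ENNReal.ofReal coneConst * ENNReal.ofReal coneConst) *
        (ENNReal.ofReal coneConst * (ENNReal.ofReal (4 * Real.pi) * Irad t))) := by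
  rw [haar_nearlyCommuting_eq_radK ht, Irad, lintegral_const_mul' _ _ ENNReal.ofReal_ne_top]

/-! ## §39 One-dimensional integrals in `a₀` -/

/-- `∫_{(0,1)} r³ dr = 1/4` and `∫_{(u,v]} r³ = (v⁴ − u⁴)/4` as Lebesgue integrals (`0 ≤ u ≤ v`). [folklore] -/
theorem lintegral_cube_Ioc {u v : ℝ} (hu : 0 ≤ u) (huv : u ≤ v) :
    ∫⁻ r in Ioc u v, ENNReal.ofReal (|r| ^ 3) = ENNReal.ofReal ((v ^ 4 - u ^ 4) / 4) := by
  have hint : IntegrableOn (fun r : ℝ => |r| ^ 3) (Ioc u v) := (by fun_prop : Continuous fun r : ℝ => |r| ^ 3).integrableOn_Ioc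
  have hnn : 0 ≤ᵐ[volume.restrict (Ioc u v)] fun r : ℝ => |r| ^ 3 := Filter.Eventually.of_forall fun r => by positivity
  rw [← ofReal_integral_eq_lintegral_ofReal hint hnn, ← intervalIntegral.integral_of_le huv]
  have e : ∫ r in u..v, |r| ^ 3 = ∫ r in u..v, r ^ 3 := by
    refine intervalIntegral.integral_congr fun r hr => ?_
    rw [Set.uIcc_of_le huv] at hr
    rw [abs_of_nonneg (hu.trans hr.1)]
  rw [e, integral_pow]; norm_num

/-- The mirror image: `∫_{[-v,-u)} |r|³ = (v⁴ − u⁴)/4` (`0 ≤ u ≤ v`). [folklore] -/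
theorem lintegral_cube_Ico_neg {u v : ℝ} (hu : 0 ≤ u) (huv : u ≤ v) :
    ∫⁻ r in Ico (-v) (-u), ENNReal.ofReal (|r| ^ 3) = ENNReal.ofReal ((v ^ 4 - u ^ 4) / 4) := by
  have hint : IntegrableOn (fun r : ℝ => |r| ^ 3) (Ico (-v) (-u)) := (by fun_prop : Continuous fun r : ℝ => |r| ^ 3).integrableOn_Icc.mono_set Ico_subset_Icc_self
  have hnn : 0 ≤ᵐ[volume.restrict (Ico (-v) (-u))] fun r : ℝ => |r| ^ 3 := Filter.Eventually.of_forall fun r => by positivity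
  rw [← ofReal_integral_eq_lintegral_ofReal hint hnn, MeasureTheory.integral_Ico_eq_integral_Ioo, ← MeasureTheory.integral_Ioc_eq_integral_Ioo,
    ← intervalIntegral.integral_of_le (by linarith)]
  have e : ∫ r in (-v)..(-u), |r| ^ 3 = ∫ r in (-v)..(-u), -(r ^ 3) := by
    refine intervalIntegral.integral_congr fun r hr => ?_
    rw [Set.uIcc_of_le (by linarith)] at hr
    rw [abs_of_nonpos (by linarith [hr.2])]; ring
  rw [e, intervalIntegral.integral_neg, integral_pow]; congr 1; ring

/-- ★ `∫_{a₀² < 1} |a₀|³ da₀ = 1/2`. [folklore] -/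
theorem lintegral_cube_unit : ∫⁻ r in {r : ℝ | r ^ 2 < 1}, ENNReal.ofReal (|r| ^ 3) = ENNReal.ofReal (1 / 2) := by
  have e : {r : ℝ | r ^ 2 < 1} = Ioc (-1 : ℝ) 0 ∪ Ioo (0 : ℝ) 1 := by
    ext r
    simp only [Set.mem_setOf_eq, Set.mem_union, Set.mem_Ioc, Set.mem_Ioo, sq_lt_one_iff_abs_lt_one, abs_lt]
    constructor
    · rintro ⟨h1, h2⟩
      rcases le_or_gt r 0 with h | h
      · exact Or.inl ⟨h1, h⟩
      · exact Or.inr ⟨h, h2⟩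
    · rintro (⟨h1, h2⟩ | ⟨h1, h2⟩)
      · exact ⟨h1, by linarith⟩
      · exact ⟨by linarith, h2⟩
  rw [e, lintegral_union measurableSet_Ioo (by
      rw [Set.disjoint_iff]; rintro r ⟨⟨-, h1⟩, ⟨h2, -⟩⟩; simp only [Set.mem_empty_iff_false]; linarith)]
  have h1 : ∫⁻ r in Ioc (-1 : ℝ) 0, ENNReal.ofReal (|r| ^ 3) = ENNReal.ofReal ((1 ^ 4 - 0 ^ 4) / 4) := by
    have h := lintegral_cube_Ico_neg (u := 0) (v := 1) le_rfl zero_le_one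
    rw [neg_zero] at h
    rw [← h]
    exact setLIntegral_congr ((Ioo_ae_eq_Ioc (μ := (volume : Measure ℝ))).symm.trans Ioo_ae_eq_Ico)
  have h2 : ∫⁻ r in Ioo (0 : ℝ) 1, ENNReal.ofReal (|r| ^ 3) = ENNReal.ofReal ((1 ^ 4 - 0 ^ 4) / 4) := by
    rw [← lintegral_cube_Ioc le_rfl zero_le_one]
    exact setLIntegral_congr Ioo_ae_eq_Ioc
  rw [h1, h2, ← ENNReal.ofReal_add (by norm_num) (by norm_num)]; norm_num

/-- ★ `∫_{r₀ < |a₀|, a₀² + δ² < 1} |a₀|³ da₀ ≥ ((1−δ²)² − r₀⁴)/2` (in fact `=`; `0 < r₀`, `r₀² + δ² < 1`). [folklore] -/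
theorem le_lintegral_cube_annulus {r₀ δ : ℝ} (hr₀ : 0 < r₀) (h : r₀ ^ 2 + δ ^ 2 < 1) :
    ENNReal.ofReal (((1 - δ ^ 2) ^ 2 - r₀ ^ 4) / 2) ≤ ∫⁻ r in {r : ℝ | r₀ < |r| ∧ r ^ 2 + δ ^ 2 < 1}, ENNReal.ofReal (|r| ^ 3) := by
  set s := Real.sqrt (1 - δ ^ 2) with hs
  have hδ1 : 0 < 1 - δ ^ 2 := by nlinarith [sq_nonneg r₀]
  have hs2 : s ^ 2 = 1 - δ ^ 2 := Real.sq_sqrt hδ1.le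
  have hrs : r₀ ≤ s := by rw [hs, ← Real.sqrt_sq hr₀.le]; exact Real.sqrt_le_sqrt (by linarith)
  -- the two half-annuli
  have hsub : Ioo r₀ s ∪ Ioo (-s) (-r₀) ⊆ {r : ℝ | r₀ < |r| ∧ r ^ 2 + δ ^ 2 < 1} := by
    rintro r (⟨h1, h2⟩ | ⟨h1, h2⟩)
    · have hr : 0 < r := hr₀.trans h1
      refine ⟨by rwa [abs_of_pos hr], ?_⟩
      nlinarith [hs2, h2, hr]
    · have hr : r < 0 := by linarith
      refine ⟨by rw [abs_of_neg hr]; linarith, ?_⟩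
      nlinarith [hs2, h1, hr]
  refine le_trans ?_ (lintegral_mono_set hsub)
  rw [lintegral_union measurableSet_Ioo (by rw [Set.disjoint_iff]; rintro r ⟨⟨h1, -⟩, ⟨-, h2⟩⟩; simp only [Set.mem_empty_iff_false]; linarith)]
  have e1 : ∫⁻ r in Ioo r₀ s, ENNReal.ofReal (|r| ^ 3) = ENNReal.ofReal ((s ^ 4 - r₀ ^ 4) / 4) := by
    rw [← lintegral_cube_Ioc hr₀.le hrs]; exact setLIntegral_congr Ioo_ae_eq_Ioc
  have e2 : ∫⁻ r in Ioo (-s) (-r₀), ENNReal.ofReal (|r| ^ 3) = ENNReal.ofReal ((s ^ 4 - r₀ ^ 4) / 4) := by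
    rw [← lintegral_cube_Ico_neg hr₀.le hrs]; exact setLIntegral_congr Ioo_ae_eq_Ico
  rw [e1, e2, ← ENNReal.ofReal_add (by nlinarith [pow_le_pow_left₀ hr₀.le hrs 4]) (by nlinarith [pow_le_pow_left₀ hr₀.le hrs 4])]
  apply ENNReal.ofReal_le_ofReal
  have : s ^ 4 = (1 - δ ^ 2) ^ 2 := by rw [show s ^ 4 = (s ^ 2) ^ 2 by ring, hs2]
  rw [this]; linarith

/-- `(a₀² + δ²)√(a₀² + δ²) ≤ |a₀|³ + 3δ` for `a₀² < 1`, `0 ≤ δ ≤ 1`. [folklore] -/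
theorem pow_three_half_le {r δ : ℝ} (hr : r ^ 2 < 1) (hδ0 : 0 ≤ δ) (hδ1 : δ ≤ 1) :
    (r ^ 2 + δ ^ 2) * Real.sqrt (r ^ 2 + δ ^ 2) ≤ |r| ^ 3 + 3 * δ := by
  have ha : |r| < 1 := (sq_lt_one_iff_abs_lt_one r).1 hr
  have ha0 : 0 ≤ |r| := abs_nonneg r
  have hsq : Real.sqrt (r ^ 2 + δ ^ 2) ≤ |r| + δ := by
    rw [← Real.sqrt_sq (by positivity : 0 ≤ |r| + δ)]
    exact Real.sqrt_le_sqrt (by rw [← sq_abs r]; nlinarith)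
  have hr2 : r ^ 2 = |r| ^ 2 := (sq_abs r).symm
  calc (r ^ 2 + δ ^ 2) * Real.sqrt (r ^ 2 + δ ^ 2) ≤ (r ^ 2 + δ ^ 2) * (|r| + δ) := by gcongr
    _ = |r| ^ 3 + (|r| ^ 2 * δ + δ ^ 2 * |r| + δ ^ 3) := by rw [hr2]; ring
    _ ≤ |r| ^ 3 + 3 * δ := by nlinarith [mul_le_one₀ ha.le ha0 ha.le, mul_nonneg hδ0 ha0]

/-! ## §40 The two-sided bounds for `I(t)` -/

/-- ★★ **UPPER BOUND**: for `0 < t`, `0 < a ≤ δ ≤ 1`, `0 < r₀`, and `B⁺` with `V_t(a₀, ρ) ≤ B⁺` whenever `r₀ < |a₀|`, `ρ ∈ (a, δ]`, `a₀² + ρ² < 1`: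
`I(t) ≤ 2(a√2/(64√t))·C_dec + 2(1/(64δ))·D + log(δ/a)/64·(8r₀·D + (1/2 + 6δ)·B⁺)`. [folklore] -/
theorem Irad_le {t a δ r₀ : ℝ} (ht : 0 < t) (ha : 0 < a) (haδ : a ≤ δ) (hδ1 : δ ≤ 1) (hr₀ : 0 < r₀) {B : ℝ≥0∞}
    (hB : ∀ r ρ : ℝ, r₀ < |r| → ρ ∈ Ioc a δ → r ^ 2 + ρ ^ 2 < 1 → Vrad t r ρ ≤ B) :
    Irad t ≤ ENNReal.ofReal 2 * (ENNReal.ofReal (a * (Real.sqrt 2 / (64 * Real.sqrt t))) * decayConst) +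
      ENNReal.ofReal 2 * (ENNReal.ofReal (1 / (64 * δ)) * (((volume : Measure ℍ).prod (volume : Measure ℍ)).prod (volume : Measure ℍ)) domSet4) +
      ENNReal.ofReal (Real.log (δ / a) / 64) * (ENNReal.ofReal (8 * r₀) * (((volume : Measure ℍ).prod (volume : Measure ℍ)).prod (volume : Measure ℍ)) domSet4 +
        ENNReal.ofReal (1 / 2 + 6 * δ) * B) := by
  set D := (((volume : Measure ℍ).prod (volume : Measure ℍ)).prod (volume : Measure ℍ)) domSet4 with hD
  have hδ : 0 < δ := ha.trans_le haδ
  have hL : 0 ≤ Real.log (δ / a) := Real.log_nonneg (by rw [le_div_iff₀ ha]; linarith)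
  -- split `(0, ∞) ⊆ (0, a] ∪ (a, δ] ∪ (δ, ∞)` for each `a₀`
  have hsplit : ∀ r : ℝ, ∫⁻ ρ in Ioi (0 : ℝ), radK t r ρ ≤
      (∫⁻ ρ in Ioc 0 a, radK t r ρ) + (∫⁻ ρ in Ioc a δ, radK t r ρ) + ∫⁻ ρ in Ioi δ, radK t r ρ := by
    intro r
    have hsub : Ioi (0 : ℝ) ⊆ (Ioc 0 a ∪ Ioc a δ) ∪ Ioi δ := by
      intro ρ hρ
      simp only [Set.mem_Ioi] at hρ
      by_cases h1 : ρ ≤ a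
      · exact Or.inl (Or.inl ⟨hρ, h1⟩)
      · by_cases h2 : ρ ≤ δ
        · exact Or.inl (Or.inr ⟨not_le.1 h1, h2⟩)
        · exact Or.inr (not_le.1 h2)
    exact (lintegral_mono_set hsub).trans ((lintegral_union_le _ _ _).trans (add_le_add (lintegral_union_le _ _ _) le_rfl))
  -- the middle piece, pointwise in `a₀`
  have hmid : ∀ r : ℝ, ∫⁻ ρ in Ioc a δ, radK t r ρ ≤ ENNReal.ofReal (Real.log (δ / a) / 64) *
      ({r : ℝ | r ^ 2 < 1}.indicator (fun r => ENNReal.ofReal (|r| ^ 3 + 3 * δ)) r * (if r₀ < |r| then B else D)) := by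
    intro r
    by_cases hr : r ^ 2 < 1
    · rw [Set.indicator_of_mem (show r ∈ {r : ℝ | r ^ 2 < 1} from hr)]
      have hBr : ∀ ρ : ℝ, ρ ∈ Ioc a δ → r ^ 2 + ρ ^ 2 < 1 → Vrad t r ρ ≤ (if r₀ < |r| then B else D) := by
        intro ρ hρ hin
        split_ifs with h
        · exact hB r ρ h hρ hin
        · exact Vrad_le_domSet4 t r (ha.trans hρ.1)
      refine (lintegral_radK_middle_le ha haδ hBr).trans ?_
      rw [← mul_assoc]
      gcongr
      rw [← ENNReal.ofReal_mul (div_nonneg hL (by norm_num))]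
      apply ENNReal.ofReal_le_ofReal
      have := pow_three_half_le hr hδ.le hδ1
      calc (r ^ 2 + δ ^ 2) * Real.sqrt (r ^ 2 + δ ^ 2) / 64 * Real.log (δ / a)
          = Real.log (δ / a) / 64 * ((r ^ 2 + δ ^ 2) * Real.sqrt (r ^ 2 + δ ^ 2)) := by ring
        _ ≤ Real.log (δ / a) / 64 * (|r| ^ 3 + 3 * δ) := by gcongr
    · have hz0 : ∀ ρ : ℝ, radK t r ρ = 0 := fun ρ => radK_eq_zero (by nlinarith [sq_nonneg ρ])
      simp only [hz0, lintegral_zero]; exact zero_le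
  -- integrate the middle bound in `a₀`
  have hmidInt : ∫⁻ r : ℝ, {r : ℝ | r ^ 2 < 1}.indicator (fun r => ENNReal.ofReal (|r| ^ 3 + 3 * δ)) r * (if r₀ < |r| then B else D) ≤
      ENNReal.ofReal (8 * r₀) * D + ENNReal.ofReal (1 / 2 + 6 * δ) * B := by
    have hm1 : MeasurableSet {r : ℝ | r ^ 2 < 1} := measurableSet_lt (measurable_id.pow_const 2) measurable_const
    have hpt : ∀ r : ℝ, {r : ℝ | r ^ 2 < 1}.indicator (fun r => ENNReal.ofReal (|r| ^ 3 + 3 * δ)) r * (if r₀ < |r| then B else D) ≤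
        (Icc (-r₀) r₀).indicator (fun _ => ENNReal.ofReal 4 * D) r + {r : ℝ | r ^ 2 < 1}.indicator (fun r => ENNReal.ofReal (|r| ^ 3 + 3 * δ)) r * B := by
      intro r
      by_cases hr : r ^ 2 < 1
      · rw [Set.indicator_of_mem (show r ∈ {r : ℝ | r ^ 2 < 1} from hr)]
        split_ifs with h
        · exact le_add_of_nonneg_left zero_le
        · have hI : r ∈ Icc (-r₀) r₀ := by
            have := not_lt.1 h; rw [abs_le] at this; exact ⟨this.1, this.2⟩
          rw [Set.indicator_of_mem hI]
          refine le_add_of_le_of_nonneg (mul_le_mul' (ENNReal.ofReal_le_ofReal ?_) le_rfl) zero_le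
          have ha1 : |r| < 1 := (sq_lt_one_iff_abs_lt_one r).1 hr
          nlinarith [abs_nonneg r, pow_le_one₀ (abs_nonneg r) ha1.le (n := 3)]
      · rw [Set.indicator_of_notMem (show r ∉ {r : ℝ | r ^ 2 < 1} from hr), zero_mul]; exact zero_le
    calc _ ≤ ∫⁻ r : ℝ, ((Icc (-r₀) r₀).indicator (fun _ => ENNReal.ofReal 4 * D) r +
          {r : ℝ | r ^ 2 < 1}.indicator (fun r => ENNReal.ofReal (|r| ^ 3 + 3 * δ)) r * B) := lintegral_mono hpt
      _ = ENNReal.ofReal 4 * D * volume (Icc (-r₀) r₀) + (∫⁻ r : ℝ, {r : ℝ | r ^ 2 < 1}.indicator (fun r => ENNReal.ofReal (|r| ^ 3 + 3 * δ)) r) * B := by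
          have hmA : Measurable fun r : ℝ => (Icc (-r₀) r₀).indicator (fun _ => ENNReal.ofReal 4 * D) r := Measurable.indicator measurable_const measurableSet_Icc
          have hf3 : Measurable fun r : ℝ => ENNReal.ofReal (|r| ^ 3 + 3 * δ) := ENNReal.measurable_ofReal.comp ((measurable_id.abs.pow_const 3).add_const _)
          have hmI : Measurable fun r : ℝ => {r : ℝ | r ^ 2 < 1}.indicator (fun r => ENNReal.ofReal (|r| ^ 3 + 3 * δ)) r := hf3.indicator hm1
          rw [lintegral_add_left hmA, lintegral_indicator measurableSet_Icc, setLIntegral_const, lintegral_mul_const _ hmI]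
      _ = ENNReal.ofReal (8 * r₀) * D + ENNReal.ofReal (1 / 2 + 6 * δ) * B := by
          rw [Real.volume_Icc, show r₀ - -r₀ = 2 * r₀ by ring, lintegral_indicator hm1]
          have hsplit : ∫⁻ r in {r : ℝ | r ^ 2 < 1}, ENNReal.ofReal (|r| ^ 3 + 3 * δ) =
              (∫⁻ r in {r : ℝ | r ^ 2 < 1}, ENNReal.ofReal (|r| ^ 3)) + ∫⁻ r in {r : ℝ | r ^ 2 < 1}, ENNReal.ofReal (3 * δ) := by
            have hm3 : Measurable fun r : ℝ => ENNReal.ofReal (|r| ^ 3) := ENNReal.measurable_ofReal.comp (measurable_id.abs.pow_const 3)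
            rw [← lintegral_add_left hm3]
            refine lintegral_congr fun r => ?_
            rw [ENNReal.ofReal_add (by positivity) (by positivity)]
          have hvol : volume {r : ℝ | r ^ 2 < 1} = ENNReal.ofReal 2 := by
            have e : {r : ℝ | r ^ 2 < 1} = Ioo (-1 : ℝ) 1 := by
              ext r; simp only [Set.mem_setOf_eq, Set.mem_Ioo, sq_lt_one_iff_abs_lt_one, abs_lt]
            rw [e, Real.volume_Ioo]; norm_num
          rw [hsplit, lintegral_cube_unit, setLIntegral_const, hvol, ← ENNReal.ofReal_mul (by positivity), ← ENNReal.ofReal_add (by norm_num) (by positivity),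
            mul_comm (ENNReal.ofReal 4 * D), ← mul_assoc, ← ENNReal.ofReal_mul (by positivity)]
          congr 2 <;> ring_nf
  -- assemble
  calc Irad t ≤ ∫⁻ r : ℝ, ((∫⁻ ρ in Ioc 0 a, radK t r ρ) + (∫⁻ ρ in Ioc a δ, radK t r ρ) + ∫⁻ ρ in Ioi δ, radK t r ρ) := lintegral_mono hsplit
    _ = (∫⁻ r : ℝ, ∫⁻ ρ in Ioc 0 a, radK t r ρ) + (∫⁻ r : ℝ, ∫⁻ ρ in Ioc a δ, radK t r ρ) + ∫⁻ r : ℝ, ∫⁻ ρ in Ioi δ, radK t r ρ := by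
        have mA : Measurable fun r : ℝ => (∫⁻ ρ in Ioc 0 a, radK t r ρ) + ∫⁻ ρ in Ioc a δ, radK t r ρ :=
          (measurable_lintegral_radK t _).add (measurable_lintegral_radK t _)
        have mB : Measurable fun r : ℝ => ∫⁻ ρ in Ioc 0 a, radK t r ρ := measurable_lintegral_radK t _
        rw [lintegral_add_left mA, lintegral_add_left mB]
    _ ≤ ENNReal.ofReal 2 * (ENNReal.ofReal (a * (Real.sqrt 2 / (64 * Real.sqrt t))) * decayConst) +
          ENNReal.ofReal (Real.log (δ / a) / 64) * (ENNReal.ofReal (8 * r₀) * D + ENNReal.ofReal (1 / 2 + 6 * δ) * B) +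
          ENNReal.ofReal 2 * (ENNReal.ofReal (1 / (64 * δ)) * D) := by
        gcongr
        · exact lintegral_radK_deep_le ht ha
        · calc ∫⁻ r : ℝ, ∫⁻ ρ in Ioc a δ, radK t r ρ
              ≤ ∫⁻ r : ℝ, ENNReal.ofReal (Real.log (δ / a) / 64) *
                  ({r : ℝ | r ^ 2 < 1}.indicator (fun r => ENNReal.ofReal (|r| ^ 3 + 3 * δ)) r * (if r₀ < |r| then B else D)) := lintegral_mono hmid
            _ ≤ _ := by rw [lintegral_const_mul' _ _ ENNReal.ofReal_ne_top]; gcongr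
        · exact lintegral_radK_outer_le t hδ
    _ = _ := by ring

/-- ★★ **LOWER BOUND**: for `0 < a ≤ δ`, `0 < r₀` with `r₀² + δ² < 1`, and `B⁻` with `B⁻ ≤ V_t(a₀, ρ)` whenever `r₀ < |a₀|`, `a₀² + δ² < 1`,
`ρ ∈ (a, δ]`: `log(δ/a)/64 · ((1−δ²)² − r₀⁴)/2 · B⁻ ≤ I(t)`. [folklore] -/
theorem le_Irad {t a δ r₀ : ℝ} (ha : 0 < a) (haδ : a ≤ δ) (hr₀ : 0 < r₀) (hrδ : r₀ ^ 2 + δ ^ 2 < 1) {B : ℝ≥0∞}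
    (hB : ∀ r ρ : ℝ, r₀ < |r| → r ^ 2 + δ ^ 2 < 1 → ρ ∈ Ioc a δ → B ≤ Vrad t r ρ) :
    ENNReal.ofReal (Real.log (δ / a) / 64) * (ENNReal.ofReal (((1 - δ ^ 2) ^ 2 - r₀ ^ 4) / 2) * B) ≤ Irad t := by
  have hL : 0 ≤ Real.log (δ / a) := Real.log_nonneg (by rw [le_div_iff₀ ha]; linarith)
  set S := {r : ℝ | r₀ < |r| ∧ r ^ 2 + δ ^ 2 < 1} with hS
  have hSm : MeasurableSet S := by
    rw [hS]
    exact (measurableSet_lt measurable_const measurable_id.abs).inter (measurableSet_lt ((measurable_id.pow_const 2).add_const _) measurable_const)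
  -- pointwise lower bound on `S`
  have hpt : ∀ r : ℝ, S.indicator (fun r => ENNReal.ofReal (Real.log (δ / a) / 64) * (ENNReal.ofReal (|r| ^ 3) * B)) r ≤ ∫⁻ ρ in Ioi (0 : ℝ), radK t r ρ := by
    intro r
    by_cases hr : r ∈ S
    · rw [Set.indicator_of_mem hr]
      have h1 := le_lintegral_radK_middle ha haδ hr.2 (fun ρ hρ => hB r ρ hr.1 hr.2 hρ) (t := t)
      refine le_trans (le_of_eq ?_) (h1.trans (lintegral_mono_set (fun ρ hρ => ha.trans hρ.1)))
      rw [← mul_assoc, ← ENNReal.ofReal_mul (div_nonneg hL (by norm_num))]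
      congr 2; ring
    · rw [Set.indicator_of_notMem hr]; exact zero_le
  calc ENNReal.ofReal (Real.log (δ / a) / 64) * (ENNReal.ofReal (((1 - δ ^ 2) ^ 2 - r₀ ^ 4) / 2) * B)
      ≤ ENNReal.ofReal (Real.log (δ / a) / 64) * ((∫⁻ r in S, ENNReal.ofReal (|r| ^ 3)) * B) := by
        gcongr; exact le_lintegral_cube_annulus hr₀ hrδ
    _ = ∫⁻ r : ℝ, S.indicator (fun r => ENNReal.ofReal (Real.log (δ / a) / 64) * (ENNReal.ofReal (|r| ^ 3) * B)) r := by
        have hm3 : Measurable fun r : ℝ => ENNReal.ofReal (|r| ^ 3) := ENNReal.measurable_ofReal.comp (measurable_id.abs.pow_const 3)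
        rw [lintegral_indicator hSm, lintegral_const_mul' _ _ ENNReal.ofReal_ne_top, lintegral_mul_const _ hm3]
    _ ≤ Irad t := lintegral_mono hpt

end Summit.QuantumFields.YangMills.Theorems.SwapVirialDeficit.ZeroModeGroup

end
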